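import Summits.Ventures.PercRepro.C041ConeClassE
import Summits.Ventures.PercRepro.C041TreeBridgeDefs

/-!
# ROW C-041 — PACKAGED ANCHORED ZONES, ITERATED GLUING AT THE ANCHOR, AND THE TREE MODEL (p6, gen 30)

`AZone` packages a zone with its carrier types and an anchor, so that the two operations of the class `IsZe`
(`C041ConeClassE`) become maps `AZone → AZone → AZone` (`glue`: gluing at the anchors) and `AZone → AZone`
(`edgePendant`: the package hung by ONE EDGE — the graph `K₂` on `Bool`, the package at `true`, the anchor `false`),
and families can be folded: `foldGlue d f acc` glues the `d` packages `f j` at the anchor onto `acc`.  Membership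
in the class is preserved by each (`isZe_glue`, `isZe_edgePendant`, `isZe_foldGlue`).  THE TREE MODEL of a rooted
marked tree `t : TZ` (`C041TreeStates` / `C041TreeBridgeDefs`): the marked point of the root glued at the root with
the edge-pendants of the children's models (`treeModel`, by recursion on the tree) — a member of the class
(`isZe_treeModel`), so its six-vector lies in the cone (`inCone_treeModel`).  NOT here: the embedding of mine-3's
canonical zone `t.toZone` into `(treeModel t).Z` (the positions into the nested sums), which would put `t.toZone`
itself into `IsZe` by `embDown` — the successor's item; `sigmaFinLast` (a `Σ`-type over `Fin (d + 1)` split into the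
first `d` fibres and the last, the shape of the fold) is the first piece of it.
-/

namespace PercRepro

namespace ZoneZ

open ZoneData TreeClosure Pendant AnchorGlue PointZone

/-- A PACKAGED ANCHORED ZONE: the carrier types, the zone and an anchor. -/
structure AZone where
  /-- the vertices -/
  V : Type
  /-- the edges -/
  E : Type
  /-- the `1`-edges -/
  T₁ : Type
  /-- the `2`-edges -/
  T₂ : Type
  /-- the zone -/
  Z : ZoneData V E T₁ T₂
  /-- the anchor -/
  k : V

namespace AZone

/-- Membership of the package in the class `IsZe`. -/
def IsZe (A : AZone) : Prop := ZoneZ.IsZe A.Z A.k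

/-- The marked point as a package. -/
abbrev point (p q : ℕ) : AZone := ⟨Unit, Empty, Fin p, Fin q, pointZone p q, ()⟩

/-- The marked point is a member. -/
theorem isZe_point (p q : ℕ) : (point p q).IsZe :=
  ZoneZ.IsZe.oneVertex _ () (fun _ => rfl) (fun _ => rfl) ()

/-- Gluing two packages at their anchors. -/
noncomputable abbrev glue (A B : AZone) : AZone :=
  ⟨A.V ⊕ B.V, A.E ⊕ B.E, A.T₁ ⊕ B.T₁, A.T₂ ⊕ B.T₂, AnchorGlue.glue A.Z A.k B.Z B.k, Sum.inl A.k⟩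

/-- Gluing preserves membership. -/
theorem isZe_glue {A B : AZone} (hA : A.IsZe) (hB : B.IsZe) : (glue A B).IsZe :=
  ZoneZ.IsZe.glue A.Z A.k B.Z B.k hA hB

/-- The single edge `false — true` on two vertices, unmarked. -/
def K₂ : ZoneData Bool Unit Empty Empty := ⟨fun _ => false, fun _ => true, Empty.elim, Empty.elim⟩

/-- A package hung by one edge: the zone at the far end `true` of `K₂`, the anchor at `false`. -/
noncomputable abbrev edgePendant (A : AZone) : AZone :=
  ⟨Bool ⊕ A.V, Unit ⊕ A.E, A.T₁, A.T₂, pendant K₂ true A.Z A.k, Sum.inl false⟩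

/-- Hanging by one edge preserves membership. -/
theorem isZe_edgePendant {A : AZone} (hA : A.IsZe) : (edgePendant A).IsZe :=
  ZoneZ.IsZe.pendant K₂ true false A.Z A.k hA

/-- Iterated gluing at the anchor: the `d` packages `f j` glued onto the accumulator, last one outermost. -/
noncomputable def foldGlue : (d : ℕ) → (Fin d → AZone) → AZone → AZone
  | 0, _, acc => acc
  | d + 1, f, acc => glue (foldGlue d (fun j => f j.castSucc) acc) (f (Fin.last d))

/-- Iterated gluing preserves membership. -/
theorem isZe_foldGlue : ∀ (d : ℕ) (f : Fin d → AZone) (acc : AZone), (∀ j, (f j).IsZe) → acc.IsZe →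
    (foldGlue d f acc).IsZe
  | 0, _, _, _, hacc => hacc
  | d + 1, f, acc, hf, hacc =>
    isZe_glue (isZe_foldGlue d (fun j => f j.castSucc) acc (fun _ => hf _) hacc) (hf _)

/-- THE TREE MODEL: the root's marked point glued at the root with the edge-pendants of the children's models. -/
noncomputable def treeModel : TZ → AZone
  | .node p q d cs => foldGlue d (fun j => edgePendant (treeModel (cs j))) (point p q)

/-- **The tree model of every rooted marked tree is a member of the class.** -/
theorem isZe_treeModel : ∀ t : TZ, (treeModel t).IsZe
  | .node p q d cs =>
    isZe_foldGlue d _ _ (fun j => isZe_edgePendant (isZe_treeModel (cs j))) (isZe_point p q)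

/-- The six-vector of the tree model lies in the cone (every choice of the finiteness instances). -/
theorem inCone_treeModel (t : TZ) (iE : Fintype (treeModel t).E) (dE : DecidableEq (treeModel t).E)
    (i₁ : Fintype (treeModel t).T₁) (d₁ : DecidableEq (treeModel t).T₁) (i₂ : Fintype (treeModel t).T₂)
    (d₂ : DecidableEq (treeModel t).T₂) :
    InCone (@sixVec _ _ _ _ (treeModel t).Z (treeModel t).k iE dE i₁ d₁ i₂ d₂) :=
  (isZe_treeModel t).inCone iE dE i₁ d₁ i₂ d₂

/-! ## A utility for the successor's embedding: splitting a `Σ`-type over `Fin (d + 1)` -/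

/-- Splitting a `Σ`-type over `Fin (d + 1)` into the first `d` fibres and the last one (the shape of the fold). -/
def sigmaFinLast {d : ℕ} (g : Fin (d + 1) → Type) :
    (Σ j, g j) ≃ (Σ j : Fin d, g j.castSucc) ⊕ g (Fin.last d) where
  toFun x := Fin.lastCases (motive := fun j => g j → (Σ j : Fin d, g j.castSucc) ⊕ g (Fin.last d))
    (fun y => Sum.inr y) (fun j y => Sum.inl ⟨j, y⟩) x.1 x.2
  invFun s := Sum.elim (fun y => ⟨y.1.castSucc, y.2⟩) (fun y => ⟨Fin.last d, y⟩) s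
  left_inv := by
    rintro ⟨j, x⟩
    induction j using Fin.lastCases with
    | last => simp
    | cast j => simp
  right_inv := by
    rintro (⟨j, x⟩ | x)
    · simp
    · simp

/-- The splitting on a first fibre. -/
theorem sigmaFinLast_castSucc {d : ℕ} (g : Fin (d + 1) → Type) (j : Fin d) (x : g j.castSucc) :
    sigmaFinLast g ⟨j.castSucc, x⟩ = Sum.inl ⟨j, x⟩ := by
  simp [sigmaFinLast]

/-- The splitting on the last fibre. -/
theorem sigmaFinLast_last {d : ℕ} (g : Fin (d + 1) → Type) (x : g (Fin.last d)) :
    sigmaFinLast g ⟨Fin.last d, x⟩ = Sum.inr x := by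
  simp [sigmaFinLast]

end AZone

end ZoneZ

end PercRepro
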